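import Mathlib
import HarnessLib.Audit
import Summits.PneNP.PneNP.Theorems.PstarChordSystem

/-!
# The half-chord system: the core model WITHOUT Assumption A (ROUND-24, memo §7 G1 / §11 (N3), O1; target `TerminalPeelable`)

FRONTIER range-avoidance ladder, rung F-N3, ROUND 24 (cell `pnp-ideate`, planner memo `r24/CORE-BOUND-NOTES.md` §7 G1 ("conditionally killable
states: `u = a_p a_d`, `d` shared: free iff `a_d = 1`"), §11 (N3) (the base becomes a variety), prover-2 `O1-SCOPING.md` §3–§5 (half-chord semantics,
S-O1b); typed target `PstarCoreBoundTargets.TerminalPeelable` (p646951); restricted-model proof complexity — nothing here bears on `P` versus `NP`).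

S-O1b, MODEL LAYER.  Without Assumption A a maximal leaf-peelable `F ⊆ J₀` has co-edges of three kinds: CHORDS (two private AND variables,
state `(p, p')` with `p p' = u_e`), HALF-CHORDS (one private `p`, one variable `d` of the base: state `p` with `p · a_d = u_e(a)`), and co-edges
without privates (pure base constraints).  `HalfChordSystem` extends `PstarChordSystem.ChordSystem` by

* `Ok : A → Prop` — admissible base points (the variety cut out by the private-free co-edges),
* `pin : ι → A → Option 𝔽₂` — for a half-chord the value `a_d` PINNING the second state component (`none` for a chord);

a state is ADMISSIBLE (`Adm`) when `s₁ s₂ = u_e(a)` and `s₂` equals its pin if pinned.  A pinned chord is DEAD at `a` (`Dead`) when `a_d = 0` but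
`u_e(a) = 1` (no admissible state: the base point is excluded by `e` alone), FIXED when `a_d = 1` (`s₁ = u_e(a)` forced, ON or OFF), and FREE
when `a_d = 0 = u_e(a)` (`s₁` a free bit — a "killable" chord with ONE read vector `ρ_e`).

Results (the two foundation stones of memo §10 in this generality):
* `read_or_dead_of_chordMinimal` — **M-read for half-chords**: at a witness of chord-minimality the deleted co-edge is READ or DEAD (the new
  O1 phenomenon of `O1-SCOPING.md` §4: deleting a half-chord can revive a base point);
* `not_reach_of_infeasible` — **R2, the pointwise sumset condition**: at an admissible base point with no dead co-edge, the target corrected by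
  the FIXED contributions (chords forced ON, pinned `a_d = 1`) is not reachable over the FREE co-edges (`PstarReadSumset.Reach` with second read
  vector `0` for the free half-chords) — so `PstarReadSumset.reach_all_or` yields (U1)/(U2) pointwise exactly as under Assumption A;
* `infeasible_of_chordSystem` / `toHalf` — a `ChordSystem` is the half-chord system with no pins and `Ok = ⊤` (conservativity).
The instance layer (bridge data with half-chords, Lift over the variety) is the sequel.
-/

set_option linter.dupNamespace false -- `Summit.PneNP.PneNP.…`: summit = sub-problem name (D-0017 single-conjunct layout)

open Finset
open Summit.PneNP.PneNP.Theorems.PstarReadSumset (V2 Reach)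
open Summit.PneNP.PneNP.Theorems.PstarChordSystem (ChordSystem)

namespace Summit.PneNP.PneNP.Theorems.PstarHalfChordSystem

/-- Every element of `𝔽₂` is `0` or `1`. -/
private theorem zmod2_cases (t : ZMod 2) : t = 0 ∨ t = 1 := by
  revert t; decide

/-- In `𝔽₂`: `a * b = 1 ⇒ a = 1 ∧ b = 1`. -/
private theorem eq_one_of_mul_eq_one {a b : ZMod 2} (h : a * b = 1) : a = 1 ∧ b = 1 := by
  revert a b; decide

variable {ι A : Type*}

/-- **Half-chord system**: a chord system with admissible base points and optional pins of the second state component. -/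
structure HalfChordSystem (ι A : Type*) extends ChordSystem ι A where
  /-- admissible base points (the variety of the private-free co-edges) -/
  Ok : A → Prop
  /-- pin of the second state component: `some (a_d)` for a half-chord with shared variable `d`, `none` for a chord -/
  pin : ι → A → Option (ZMod 2)

namespace HalfChordSystem

variable [DecidableEq ι] (S : HalfChordSystem ι A)

/-- Admissible states on `E` at `a`: the product condition and the pins. -/
def Adm (E : Finset ι) (a : A) (s : ι → ZMod 2 × ZMod 2) : Prop :=
  ∀ e ∈ E, (s e).1 * (s e).2 = S.u e a ∧ ∀ v, S.pin e a = some v → (s e).2 = v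

/-- INFEASIBLE: no admissible state at any admissible base point hits the target. -/
def Infeasible (E : Finset ι) : Prop := ∀ a, S.Ok a → ∀ s, S.Adm E a s → S.val E a s ≠ S.t

/-- CHORD-MINIMAL in `e`: without the conditions of `e` (product AND pin) the target is hit at an admissible base point. -/
def ChordMinimal (E : Finset ι) (e : ι) : Prop := ∃ a, S.Ok a ∧ ∃ s, S.Adm (E.erase e) a s ∧ S.val E a s = S.t

/-- DEAD at `a`: pinned to `0` but prescribed `1` — no admissible state. -/
def Dead (e : ι) (a : A) : Prop := S.pin e a = some 0 ∧ S.u e a = 1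

/-- FREE at `a`: a killable chord, or a half-chord with `a_d = 0 = u_e(a)` (its private is a free bit). -/
def Free (e : ι) (a : A) : Prop := S.u e a = 0 ∧ (S.pin e a = none ∨ S.pin e a = some 0)

/-- The second read vector as seen by the free states: `ρ'` for a chord, `0` for a (free) half-chord. -/
def ρfree (e : ι) (a : A) : V2 := if S.pin e a = none then S.ρ' e a else 0

/-- The contribution of a NON-free, non-dead co-edge (it has exactly one admissible state): `ρ + ρ'` for a chord forced ON, `u ρ + ρ'` for
a half-chord pinned to `1`. -/
def fixedContrib (e : ι) (a : A) : V2 := S.u e a • S.ρ e a + S.ρ' e a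

/-! ## Bookkeeping -/

/-- Re-imposing the conditions of `e` by updating its state. -/
theorem adm_update {E : Finset ι} {a : A} {s : ι → ZMod 2 × ZMod 2} {e : ι} (h : S.Adm (E.erase e) a s) {x : ZMod 2 × ZMod 2}
    (hx : x.1 * x.2 = S.u e a) (hpin : ∀ v, S.pin e a = some v → x.2 = v) : S.Adm E a (Function.update s e x) := by
  intro e' he'
  by_cases hee : e' = e
  · subst hee; rw [Function.update_self]; exact ⟨hx, hpin⟩
  · rw [Function.update_of_ne hee]; exact h e' (mem_erase.2 ⟨hee, he'⟩)

omit [DecidableEq ι] in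
/-- **A co-edge that is not dead has an admissible state** (`(u, 1)` for a chord; `(u, v)` resp. `(0, 0)` for a half-chord). -/
theorem exists_adm_state {e : ι} {a : A} (hd : ¬ S.Dead e a) :
    ∃ x : ZMod 2 × ZMod 2, x.1 * x.2 = S.u e a ∧ ∀ v, S.pin e a = some v → x.2 = v := by
  unfold Dead at hd
  rcases hp : S.pin e a with _ | v
  · exact ⟨(S.u e a, 1), by rw [mul_one], fun v hv => by cases hv⟩
  · rcases zmod2_cases v with rfl | rfl
    · rcases zmod2_cases (S.u e a) with hu | hu
      · exact ⟨(0, 0), by rw [hu, mul_zero], fun w hw => by cases hw; rfl⟩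
      · exact absurd ⟨hp, hu⟩ hd
    · exact ⟨(S.u e a, 1), by rw [mul_one], fun w hw => by cases hw; rfl⟩

/-! ## M-read for half-chords -/

/-- **M-read.**  Infeasible but chord-minimal in `e ∈ E`: at the witnessing base point `e` is READ or DEAD. -/
theorem read_or_dead_of_chordMinimal {E : Finset ι} (hI : S.Infeasible E) {e : ι} (he : e ∈ E) (hM : S.ChordMinimal E e) :
    ∃ a s, S.Ok a ∧ S.Adm (E.erase e) a s ∧ S.val E a s = S.t ∧ (S.toChordSystem.Read e a ∨ S.Dead e a) := by
  obtain ⟨a, hok, s, hadm, hval⟩ := hM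
  refine ⟨a, s, hok, hadm, hval, ?_⟩
  by_contra hno
  push Not at hno
  obtain ⟨hread, hdead⟩ := hno
  unfold ChordSystem.Read at hread
  push Not at hread
  obtain ⟨h1, h2⟩ := hread
  obtain ⟨x, hx, hpin⟩ := S.exists_adm_state hdead
  refine hI a hok (Function.update s e x) (S.adm_update hadm hx hpin) ?_
  rw [S.val_eq he, S.val_erase_update, S.contrib_update_self, h1, h2, smul_zero, smul_zero, add_zero, zero_add]
  rw [S.val_eq he] at hval
  unfold ChordSystem.contrib at hval
  rw [h1, h2, smul_zero, smul_zero, add_zero, zero_add] at hval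
  exact hval

/-! ## R2: the pointwise sumset condition -/

omit [DecidableEq ι] in
/-- At a base point without dead co-edges, every co-edge is free or fixed. -/
theorem free_or_fixed {e : ι} {a : A} (hd : ¬ S.Dead e a) :
    S.Free e a ∨ (¬ S.Free e a ∧ ∀ x : ZMod 2 × ZMod 2, x.1 * x.2 = S.u e a → (∀ v, S.pin e a = some v → x.2 = v) →
      x.1 • S.ρ e a + x.2 • S.ρ' e a = S.fixedContrib e a) := by
  by_cases hf : S.Free e a
  · exact Or.inl hf
  · refine Or.inr ⟨hf, fun x hx hpin => ?_⟩
    unfold Free at hf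
    unfold Dead at hd
    unfold fixedContrib
    rcases hp : S.pin e a with _ | v
    · -- a chord that is not free is forced ON
      have hu : S.u e a = 1 := by
        rcases zmod2_cases (S.u e a) with h | h
        · exact absurd ⟨h, Or.inl hp⟩ hf
        · exact h
      rw [hu] at hx
      have h11 : x.1 = 1 ∧ x.2 = 1 := eq_one_of_mul_eq_one hx
      rw [h11.1, h11.2, hu, one_smul, one_smul]
    · have hx2 : x.2 = v := hpin v hp
      rcases zmod2_cases v with rfl | rfl
      · -- pinned to `0`: then `u = 0` (not dead) — but then free, contradiction
        rcases zmod2_cases (S.u e a) with hu | hu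
        · exact absurd ⟨hu, Or.inr hp⟩ hf
        · exact absurd ⟨hp, hu⟩ hd
      · rw [hx2, mul_one] at hx
        rw [hx, hx2, one_smul]

omit [DecidableEq ι] in
open scoped Classical in
/-- **Infeasibility pointwise (memo R2) without Assumption A.**  At an admissible base point with no dead co-edge, the target corrected by the
state-free part and the fixed contributions is NOT reachable over the free co-edges (free half-chords read with their single vector `ρ`). -/
theorem not_reach_of_infeasible {E : Finset ι} (hI : S.Infeasible E) {a : A} (hok : S.Ok a) (hd : ∀ e ∈ E, ¬ S.Dead e a) :
    ¬ Reach (E.filter fun e => S.Free e a) (fun e => S.ρ e a) (fun e => S.ρfree e a)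
      (S.t + S.F a + ∑ e ∈ E.filter (fun e => ¬ S.Free e a), S.fixedContrib e a) := by
  classical
  rintro ⟨g, hg, hsum⟩
  -- realise the choice `g` by admissible states on the free co-edges, and the unique state on the fixed ones
  have hfix : ∀ e, ∃ x : ZMod 2 × ZMod 2, ¬ S.Dead e a → x.1 * x.2 = S.u e a ∧ ∀ v, S.pin e a = some v → x.2 = v := by
    intro e
    by_cases h : S.Dead e a
    · exact ⟨(0, 0), fun h' => absurd h h'⟩
    · obtain ⟨x, hx⟩ := S.exists_adm_state h
      exact ⟨x, fun _ => hx⟩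
  choose xfix hxfix using hfix
  let s : ι → ZMod 2 × ZMod 2 := fun e =>
    if S.Free e a then (if g e = S.ρ e a then (1, 0) else if g e = S.ρfree e a ∧ S.pin e a = none then (0, 1) else (0, 0)) else xfix e
  have hfree_adm : ∀ e ∈ E, S.Free e a → (s e).1 * (s e).2 = S.u e a ∧ ∀ v, S.pin e a = some v → (s e).2 = v := by
    intro e _ hf
    have hu : S.u e a = 0 := hf.1
    simp only [s, hf, if_true]
    split_ifs with h1 h2
    · exact ⟨by rw [hu]; simp, fun v hv => by
        rcases hf.2 with hp | hp
        · rw [hp] at hv; cases hv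
        · rw [hp] at hv; cases hv; rfl⟩
    · exact ⟨by rw [hu]; simp, fun v hv => by rw [h2.2] at hv; cases hv⟩
    · exact ⟨by rw [hu]; simp, fun v hv => by
        rcases hf.2 with hp | hp
        · rw [hp] at hv; cases hv
        · rw [hp] at hv; cases hv; rfl⟩
  have hadm : S.Adm E a s := by
    intro e he
    by_cases hf : S.Free e a
    · exact hfree_adm e he hf
    · simp only [s, hf, if_false]
      exact hxfix e (hd e he)
  have hkill : ∀ e ∈ E.filter (fun e => S.Free e a), S.contrib a s e = g e := by
    intro e he
    obtain ⟨heE, hf⟩ := mem_filter.1 he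
    unfold ChordSystem.contrib
    simp only [s, hf, if_true]
    by_cases h1 : g e = S.ρ e a
    · rw [if_pos h1, h1, one_smul, zero_smul, add_zero]
    · rw [if_neg h1]
      by_cases h2 : g e = S.ρfree e a ∧ S.pin e a = none
      · rw [if_pos h2, zero_smul, one_smul, zero_add, h2.1]
        unfold ρfree; rw [if_pos h2.2]
      · rw [if_neg h2, zero_smul, zero_smul, add_zero]
        rcases hg e he with h | h | h
        · exact h.symm
        · exact absurd h h1
        · -- `g e = ρfree e a`: then the pin is not `none` (else `h2`), so `ρfree = 0`
          by_cases hp : S.pin e a = none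
          · exact absurd ⟨h, hp⟩ h2
          · rw [h]; show (0 : V2) = S.ρfree e a; unfold ρfree; rw [if_neg hp]
  have hforce : ∀ e ∈ E.filter (fun e => ¬ S.Free e a), S.contrib a s e = S.fixedContrib e a := by
    intro e he
    obtain ⟨heE, hf⟩ := mem_filter.1 he
    rcases S.free_or_fixed (hd e heE) with h | ⟨-, h⟩
    · exact absurd h hf
    · unfold ChordSystem.contrib
      simp only [s, hf, if_false]
      exact h (xfix e) (hxfix e (hd e heE)).1 (hxfix e (hd e heE)).2
  refine hI a hok s hadm ?_
  unfold ChordSystem.val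
  rw [← sum_filter_add_sum_filter_not E (fun e => S.Free e a), sum_congr rfl hkill, sum_congr rfl hforce, hsum]
  generalize S.F a = f
  generalize ∑ e ∈ E.filter (fun e => ¬ S.Free e a), S.fixedContrib e a = r
  have : ∀ f r tt : V2, f + (tt + f + r + r) = tt := by decide
  exact this f r S.t

/-! ## Conservativity: chord systems are half-chord systems without pins -/

/-- A chord system as a half-chord system: no pins, every base point admissible. -/
def ofChord (S : ChordSystem ι A) : HalfChordSystem ι A := { S with Ok := fun _ => True, pin := fun _ _ => none }

omit [DecidableEq ι] in
/-- Admissibility agrees. -/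
theorem adm_ofChord (S : ChordSystem ι A) (E : Finset ι) (a : A) (s : ι → ZMod 2 × ZMod 2) :
    (ofChord S).Adm E a s ↔ S.Adm E a s := by
  unfold Adm ChordSystem.Adm ofChord
  exact ⟨fun h e he => (h e he).1, fun h e he => ⟨h e he, fun v hv => by cases hv⟩⟩

omit [DecidableEq ι] in
/-- **Infeasibility agrees** (so every theorem about half-chord systems specialises to `ChordSystem`). -/
theorem infeasible_ofChord (S : ChordSystem ι A) (E : Finset ι) : (ofChord S).Infeasible E ↔ S.Infeasible E := by
  unfold Infeasible ChordSystem.Infeasible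
  constructor
  · intro h a s hadm; exact h a trivial s ((adm_ofChord S E a s).2 hadm)
  · intro h a _ s hadm; exact h a s ((adm_ofChord S E a s).1 hadm)

/-- Chord-minimality agrees. -/
theorem chordMinimal_ofChord (S : ChordSystem ι A) (E : Finset ι) (e : ι) : (ofChord S).ChordMinimal E e ↔ S.ChordMinimal E e := by
  unfold ChordMinimal ChordSystem.ChordMinimal
  constructor
  · rintro ⟨a, -, s, hadm, hval⟩; exact ⟨a, s, (adm_ofChord S _ a s).1 hadm, hval⟩
  · rintro ⟨a, s, hadm, hval⟩; exact ⟨a, trivial, s, (adm_ofChord S _ a s).2 hadm, hval⟩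

end HalfChordSystem

end Summit.PneNP.PneNP.Theorems.PstarHalfChordSystem
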